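import Summits.ResolutionOfSingularities.ResolutionOfSingularities.Theorems.EquisingularLiftEquisingularLiftNatAOddVertices
import Summits.ResolutionOfSingularities.ResolutionOfSingularities.Theorems.EquisingularLiftEquisingularLiftNatFirstOrderStrictTransform
import HarnessLib

/-!
# [OURS] `A_{2k+2}` HAS BLOW-UP DEPTH `k`: the origin of `Spec K[y₀,y₁,y₂]/(y₀y₁ + y₂^{2k+3})` has level `k` in EVERY blow-up tower (every field, every `k`),
# and `A_{even}` vertices ⟹ `IsoHypPoint` — with ✓ …NatAOddTower / …NatAOddVertices this completes the `A`-series in the depth programme's currency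
# (cruxes `Theses.EquisingularLift.EquisingularLiftNat` / `…NatThree` / `EquisingularLift`, stmt-ResolutionOfSingularities-20038 / -20148 / -15660)

[OURS · leafhand-res-equisingularlift-12 g0, 2026-08-31; cell `pub/decomp-res`] AI-produced, weaker than expert review; NOT a statement of any manuscript;
nothing here proves resolution of singularities in positive characteristic.  DEF-FREE helper; no `sorry`; standard axioms; ZERO named hypotheses.

* `SecondOrderPoint.A₂_oneStep` — one-step data for `A₂ = y₀y₁ + y₂³` (prime-ideal first-order criterion, ✓ `FirstOrderPoint.exists_strictTransform`);
* `SecondOrderPoint.A_even_strictTransform₂` — chart `2`: `f_{k+1}(T₂T₀, T₂T₁, T₂) = T₂²·f_k` for `f_k = y₀y₁ + y₂^{2k+3}`;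
* ★★★ `OneStep.towerLevel_origin_A_even` — `∀ k`, `∀ f = y₀y₁ + y₂^{2k+3}`: the origin of `Spec K[T]/(f)` has `D`-level `k` (`A₂` one-step; `A_{2k+4} → A_{2k+2}`
  at the origin of chart `2`, ✓ `towerLevel_succ_origin_marked`);
* ★★★ `isoHypPoint_of_A_evenVertices` — `K = K̄`: a prime surface whose singular points are vertices with charts `y₀y₁ + y₂^{2k_c+3}` satisfies `IsoHypPoint`.

Honest label: closes no registered stub.

References: [Hartshorne1977, I Thm. 5.1, I Ex. 5.6, II Ex. 7.12]; [Lipman1969, §24]; [StacksProject, Tags 0804, 080E]; through the cited tree files.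
-/

set_option linter.dupNamespace false -- mandated namespace `Summit.<Summit>.<Problem>` of this single-conjunct summit

noncomputable section

open CategoryTheory CategoryTheory.Limits AlgebraicGeometry TopologicalSpace Topology
open MvPolynomial
open Literature.AlgebraicGeometry.Resolution Literature.AlgebraicGeometry.Motives
open AlgebraicGeometry.Scheme.IdealSheafData
open HomogeneousLocalization
open Literature.AlgebraicGeometry.Motives.SmoothHypersurface Literature.AlgebraicGeometry.Motives.ProjectiveSpace
open Summit.ResolutionOfSingularities.ResolutionOfSingularities.Cruxes.EquisingularLift.StrataSplit

namespace Summit.ResolutionOfSingularities.ResolutionOfSingularities.Cruxes.EquisingularLiftNat.Sections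

namespace SecondOrderPoint

variable (K : Type) [Field K]

/-- **One-step data for `A₂ = y₀y₁ + y₂³`** (`Φ = y₀y₁`, `Ψ₁ = y₂³`, `Ψ'' = 0`): a prime containing `∂Φ = (y₁, y₀, 0)` and `y₂³` contains every variable.
[cite: Hartshorne1977, I Thm. 5.1, II Ex. 7.12] -/
theorem A₂_oneStep (l : Fin 3) :
    ∃ G : MvPolynomial (Fin 3) K,
      aeval (fun j => X l * Function.update (X : Fin 3 → MvPolynomial (Fin 3) K) l 1 j)
          ((X 0 * X 1 : MvPolynomial (Fin 3) K) + (X 2 ^ 3 + 0)) = X l ^ 2 * G ∧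
      ∀ P : Ideal (MvPolynomial (Fin 3) K), P.IsPrime → (X l : MvPolynomial (Fin 3) K) ∈ P → G ∈ P → ∃ j, pderiv j G ∉ P := by
  have hΦ : (X 0 * X 1 : MvPolynomial (Fin 3) K).IsHomogeneous 2 := by
    simpa using (isHomogeneous_X K (0 : Fin 3)).mul (isHomogeneous_X K (1 : Fin 3))
  refine FirstOrderPoint.exists_strictTransform K (X 0 * X 1) (X 2 ^ 3) 0 hΦ (isHomogeneous_X_pow 2 3) (Ideal.zero_mem _)
    (fun P hP _ hd hΨ i => ?_) l
  have h0 : (X 1 : MvPolynomial (Fin 3) K) ∈ P := by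
    have h := hd 0
    rwa [pderiv_mul, pderiv_X_self, pderiv_X_of_ne (by decide : (1 : Fin 3) ≠ 0), one_mul, mul_zero, add_zero] at h
  have h1 : (X 0 : MvPolynomial (Fin 3) K) ∈ P := by
    have h := hd 1
    rwa [pderiv_mul, pderiv_X_of_ne (by decide : (0 : Fin 3) ≠ 1), pderiv_X_self, zero_mul, mul_one, zero_add] at h
  have h2 : (X 2 : MvPolynomial (Fin 3) K) ∈ P := hP.mem_of_pow_mem 3 hΨ
  fin_cases i
  · simpa using h1
  · simpa using h0
  · simpa using h2

/-- **Chart `2` of `f_{k+1} = y₀y₁ + y₂^{2k+5}`**: `f_{k+1}(T₂T₀, T₂T₁, T₂) = T₂²·(T₀T₁ + T₂^{2k+3})`. [cite: Hartshorne1977, II Ex. 7.12] -/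
theorem A_even_strictTransform₂ (k : ℕ) :
    aeval (fun j => X 2 * Function.update (X : Fin 3 → MvPolynomial (Fin 3) K) 2 1 j) (X 0 * X 1 + X 2 ^ (2 * k + 5) : MvPolynomial (Fin 3) K) =
      X 2 ^ 2 * (X 0 * X 1 + X 2 ^ (2 * k + 3)) := by
  rw [map_add, aeval_subst_X_mul_X_of_ne K 2 0 1 (by decide) (by decide), map_pow, aeval_X, Function.update_self]
  ring

end SecondOrderPoint

namespace OneStep

variable (K : Type) [Field K]

/-- ★★★ **`A_{2k+2}` HAS LEVEL `k` IN EVERY BLOW-UP TOWER**: for every `k` and every `f = y₀y₁ + y₂^{2k+3}`, the origin of `Spec K[y]/(f)` has `D`-level `k`.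
[OURS] [cite: Hartshorne1977, I Thm. 5.1, I Ex. 5.6] [cite: Lipman1969, §24] [cite: StacksProject, Tag 080E] -/
theorem towerLevel_origin_A_even (D : ℕ → ∀ Γ : Scheme.{0}, Γ → Prop)
    (hD0 : ∀ (Γ : Scheme.{0}) (y : Γ), IsClosed (({y} : Set Γ)) →
      (D 0 Γ y ↔ ∀ (hy : IsClosed (({y} : Set Γ))) (Z : Scheme.{0}) (τ : Z ⟶ Γ), IsBlowup τ (vanishingIdeal ⟨{y}, hy⟩) →
        ∀ z : Z, τ z = y → IsRegularLocalRing (Z.presheaf.stalk z)))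
    (hDsucc : ∀ (d : ℕ) (Γ : Scheme.{0}) (y : Γ), IsClosed (({y} : Set Γ)) →
      (D (d + 1) Γ y ↔ ∀ (hy : IsClosed (({y} : Set Γ))) (Z : Scheme.{0}) (τ : Z ⟶ Γ), IsBlowup τ (vanishingIdeal ⟨{y}, hy⟩) →
        ∃ S' : Finset Z, (∀ z : Z, τ z = y → z ∉ S' → IsRegularLocalRing (Z.presheaf.stalk z)) ∧
          ∀ z ∈ S', τ z = y ∧ IsClosed (({z} : Set Z)) ∧ ∃ d' ≤ d, D d' Z z)) (k : ℕ) :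
    ∀ (f : MvPolynomial (Fin 3) K), f = X 0 * X 1 + X 2 ^ (2 * k + 3) →
      ∀ (y₀ : Spec (CommRingCat.of (MvPolynomial (Fin 3) K ⧸ Ideal.span {f}))),
        y₀.asIdeal = Ideal.map (Ideal.Quotient.mk (Ideal.span {f})) (Ideal.span (Set.range (X : Fin 3 → MvPolynomial (Fin 3) K))) →
        D k (Spec (CommRingCat.of (MvPolynomial (Fin 3) K ⧸ Ideal.span {f}))) y₀ := by
  classical
  have hΦ : (X 0 * X 1 : MvPolynomial (Fin 3) K).IsHomogeneous 2 := by
    simpa using (isHomogeneous_X K (0 : Fin 3)).mul (isHomogeneous_X K (1 : Fin 3))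
  have hΦ0 : (X 0 * X 1 : MvPolynomial (Fin 3) K) ≠ 0 := mul_ne_zero (X_ne_zero 0) (X_ne_zero 1)
  induction k with
  | zero =>
    intro f hf y₀ hy₀
    have e : (X 0 * X 1 : MvPolynomial (Fin 3) K) + (X 2 ^ 3 + 0) = f := by rw [hf]; ring
    subst e
    have hΨ : (X 2 ^ 3 + 0 : MvPolynomial (Fin 3) K) ∈ Ideal.span (Set.range (X : Fin 3 → MvPolynomial (Fin 3) K)) ^ (2 + 1) := by
      rw [add_zero]; exact SecondOrderPoint.X_two_pow_mem_pow_three K le_rfl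
    exact towerLevel_zero_origin K D hD0 hDsucc (X 0 * X 1) (X 2 ^ 3 + 0) (by norm_num) hΦ hΦ0 hΨ (SecondOrderPoint.A₂_oneStep K) y₀ hy₀
  | succ k ih =>
    intro f hf y₀ hy₀
    have e : (X 0 * X 1 : MvPolynomial (Fin 3) K) + X 2 ^ (2 * k + 5) = f := by rw [hf]; ring_nf
    subst e
    have hΨ : (X 2 ^ (2 * k + 5) : MvPolynomial (Fin 3) K) ∈ Ideal.span (Set.range (X : Fin 3 → MvPolynomial (Fin 3) K)) ^ (2 + 1) :=
      SecondOrderPoint.X_two_pow_mem_pow_three K (by omega)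
    obtain ⟨⟨G₀, hG₀, hJ₀⟩, ⟨G₁, hG₁, hJ₁⟩, -⟩ := SecondOrderPoint.A_charts_regular_off_origin₂ K hΨ
    have hG₂ := SecondOrderPoint.A_even_strictTransform₂ K k
    have hG₂' : (X 0 * X 1 + X 2 ^ (2 * k + 3) : MvPolynomial (Fin 3) K) - X 0 * X 1 ∈ Ideal.span {(X 2 : MvPolynomial (Fin 3) K)} :=
      Ideal.mem_span_singleton'.mpr ⟨X 2 ^ (2 * k + 2), by ring⟩
    refine towerLevel_succ_origin_marked K D hD0 hDsucc k (X 0 * X 1) (X 2 ^ (2 * k + 5)) (by norm_num) hΦ hΦ0 hΨ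
      ![G₀, G₁, X 0 * X 1 + X 2 ^ (2 * k + 3)] (fun a => ?_) ![∅, ∅, {(0 : Fin 3 → K)}] (fun a P hP haP hGP => ?_)
      (fun a lam hlam _ => ?_) y₀ hy₀
    · fin_cases a
      · exact hG₀
      · exact hG₁
      · exact hG₂
    · fin_cases a
      · exact Or.inl (hJ₀ P hP haP)
      · exact Or.inl (hJ₁ P hP haP)
      · by_cases hall : ∀ j, pderiv j (X 0 * X 1 + X 2 ^ (2 * k + 3) : MvPolynomial (Fin 3) K) ∈ P
        · right
          refine ⟨0, Finset.mem_singleton_self _, fun i => ?_⟩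
          simpa using SecondOrderPoint.forall_X_mem_of_sub_mul_mem_span₃ K hG₂' P haP (hall 0) (hall 1) i
        · left
          push Not at hall
          exact hall
    · fin_cases a
      · simp at hlam
      · simp at hlam
      · have hlam0 : lam = 0 := by simpa using hlam
        subst hlam0
        have h0 : (fun i : Fin 3 => X i + C ((0 : Fin 3 → K) i)) = (X : Fin 3 → MvPolynomial (Fin 3) K) := by
          funext i; simp
        have htr : aeval (fun i : Fin 3 => X i + C ((0 : Fin 3 → K) i)) (X 0 * X 1 + X 2 ^ (2 * k + 3) : MvPolynomial (Fin 3) K) =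
            X 0 * X 1 + X 2 ^ (2 * k + 3) := by
          simp only [h0, MvPolynomial.aeval_X_left, AlgHom.coe_id, id_eq]
        refine ⟨2, X 0 * X 1, X 2 ^ (2 * k + 3), by norm_num, hΦ, SecondOrderPoint.X_two_pow_mem_pow_three K (by omega), htr,
          fun y' hy' => ⟨k, le_rfl, ?_⟩⟩
        exact ih (X 0 * X 1 + X 2 ^ (2 * k + 3)) rfl y' hy'

end OneStep

/-- ★★★ **`A_{2k+2}` VERTICES ⟹ `IsoHypPoint`** (`K = K̄`, every characteristic): `F ∈ K[x₀,…,x₃]` a prime form whose charts at the vertices `c ∈ S` are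
`y₀y₁ + y₂^{2k_c+3}` and whose other charts are regular. [OURS] [cite: Hartshorne1977, I Thm. 5.1, I Ex. 5.6] [cite: StacksProject, Tag 080E] -/
theorem isoHypPoint_of_A_evenVertices (K : Type) [Field K] [IsAlgClosed K]
    (F : MvPolynomial (Fin (1 + 2 + 1)) K) {d : ℕ} (hF : F.IsHomogeneous d) (hFp : Prime F) (S : List (Fin (1 + 2 + 1)))
    (kexp : Fin (1 + 2 + 1) → ℕ)
    (hA : ∀ c ∈ S, ProjectiveSpace.dehomogenize K c F = X 0 * X 1 + X 2 ^ (2 * kexp c + 3))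
    (hoff : letI := MvPolynomial.gradedAlgebra (σ := Fin (1 + 2 + 1)) (R := K)
      ∀ c, c ∉ S → IsRegularRing (ChartRing F c hF)) :
    letI := MvPolynomial.gradedAlgebra (σ := Fin (1 + 2 + 1)) (R := K)
    IsoHypPoint K (1 + 2) (hypersurface F).left (hypersurfaceι F).left := by
  obtain ⟨D, hD0, hDsucc⟩ := exists_blowupTower
  have hd : 0 < d := ConeN.pos_of_prime_of_isHomogeneous K F hF hFp
  have hΦ : (X 0 * X 1 : MvPolynomial (Fin 3) K).IsHomogeneous 2 := by
    simpa using (isHomogeneous_X K (0 : Fin 3)).mul (isHomogeneous_X K (1 : Fin 3))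
  have hΨ : ∀ c, (X 2 ^ (2 * kexp c + 3) : MvPolynomial (Fin 3) K) ∈ Ideal.span (Set.range (X : Fin 3 → MvPolynomial (Fin 3) K)) ^ (2 + 1) :=
    fun c => SecondOrderPoint.X_two_pow_mem_pow_three K (by omega)
  refine isoHypPoint_of_towerVertices K D hD0 hDsucc F hF hFp S (fun c hc => ⟨2, X 0 * X 1, _, le_rfl, hΦ, hΨ c, hA c hc⟩)
    (fun c hc P hP hfP hdP j => ?_) hoff (fun c hc => ?_)
  · rw [hA c hc] at hfP hdP
    exact SecondOrderPoint.A_odd_singular_only_origin K (by omega) P hP hfP hdP j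
  · have hrad : (Ideal.span {(X 0 * X 1 + X 2 ^ (2 * kexp c + 3) : MvPolynomial (Fin 3) K)}).radical =
        Ideal.span {(X 0 * X 1 + X 2 ^ (2 * kexp c + 3) : MvPolynomial (Fin 3) K)} :=
      OrdPointAt.radical_span_dehomogenize_eq K F c hF hFp (X 0 * X 1) _ hΦ (by norm_num) (hΨ c) (hA c hc)
    obtain ⟨x₀, -, hx₀X, hlev⟩ := towerLevel_vertex_of_origin K D hD0 hDsucc (kexp c) F hF hd c (X 0 * X 1) _ (by norm_num) hΦ (hΨ c) (hA c hc) hrad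
      (fun y hy => OneStep.towerLevel_origin_A_even K D hD0 hDsucc (kexp c) _ rfl y hy)
    exact ⟨x₀, hx₀X, kexp c, hlev⟩

end Summit.ResolutionOfSingularities.ResolutionOfSingularities.Cruxes.EquisingularLiftNat.Sections

end
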